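import Summits.CriticalPhenomena.PercolationContinuityZ3.Theses.PercThresholdOne

/-!
# `MonotoneFactorImpliesLocalRule` (route PercThresholdOne, item stmt-CriticalPhenomena-14217)

Glue of the ladder's last rung, BY NAME: crux #2 `NoFragileGiantMonotoneFactor`
(no antitone lattice-equivariant measurable factor of iid edge labels, of ANY range, produces a
unique dense weaving exponentially-fragile giant) implies the target
`NoFragileGiantLocalRule` (the same statement restricted to FINITE-RANGE factors).
A finite-range antitone equivariant factor is in particular an antitone equivariant factor,
so the range hypothesis is simply dropped.
-/

namespace Summit.CriticalPhenomena.PercolationContinuityZ3.Theorems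

open Summit.CriticalPhenomena.PercolationContinuityZ3.Theses.PercThresholdOne

/-- **Support item stmt-CriticalPhenomena-14217.** `NoFragileGiantMonotoneFactor → NoFragileGiantLocalRule`:
the rule-agnostic crux (any range) specialises to finite-range rules by forgetting the range
hypothesis. -/
theorem monotoneFactorImpliesLocalRule_proof : MonotoneFactorImpliesLocalRule := by
  unfold MonotoneFactorImpliesLocalRule NoFragileGiantMonotoneFactor NoFragileGiantLocalRule
  intro h F _R hF _hRange hAS hDense
  exact h F hF hAS hDense

end Summit.CriticalPhenomena.PercolationContinuityZ3.Theorems
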